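import Literature.NumberTheory.LFunctions.PatelYangAssembly
import HarnessLib

/-!
# Patel–Yang §3.6: the bound `‖ζ(½+it)‖ ≤ Λ t^{27/164}` for `t ≥ t₀`

Topic `Literature/NumberTheory/LFunctions`. Patel–Yang 2024, §3.6 ("Computations") and Lemma 3.5
for the infinite interval: every term of the three-range bound
`Literature.NumberTheory.LFunctions.VdC.norm_zeta_half_le_blocks` is a coefficient times a power
`t^y` with `y ≤ 27/164` (the two `ABA³B` main terms have `y = 27/164` exactly), or `K₁(t) ≍ log t`;
bounding `t^{y-27/164} ≤ t₀^{y-27/164}` and `(log t)t^{-27/164} ≤ (log t₀)t₀^{-27/164}` (`t ≥ t₀`,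
`(27/164) log t₀ ≥ 1`) gives `‖ζ(½+it)‖ ≤ Λ(t₀, parameters) t^{27/164}` for all `t ≥ t₀` with an
explicit constant `Λ` (`Literature.NumberTheory.LFunctions.VdC.pyLambda`). Everything is PROVED.

## References

* D. Patel, A. Yang, *An explicit sub-Weyl bound for `ζ(1/2 + it)`*, J. Number Theory 262 (2024),
  Lemma 3.5 (infinite interval) and §3.6. [cite: PatelYang2024, §3.6]
-/

noncomputable section

open Real Set

namespace Literature.NumberTheory.LFunctions
namespace VdC

/-! ### Monotonicity lemmas in `t` -/

/-- `t^y ≤ t₀^{y-c} t^c` for `t ≥ t₀ > 0` and `y ≤ c`. [folklore] -/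
theorem rpow_le_rpow_t0 {t t₀ y c : ℝ} (ht₀ : 0 < t₀) (ht : t₀ ≤ t) (hyc : y ≤ c) :
    t ^ y ≤ t₀ ^ (y - c) * t ^ c := by
  have ht0 : 0 < t := ht₀.trans_le ht
  have h1 : t ^ y = t ^ (y - c) * t ^ c := by rw [← Real.rpow_add ht0]; ring_nf
  rw [h1]
  exact mul_le_mul_of_nonneg_right (Real.rpow_le_rpow_of_nonpos ht₀ ht (by linarith))
    (Real.rpow_nonneg ht0.le _)

/-- `(log t) t^{-c} ≤ (log t₀) t₀^{-c}` for `t ≥ t₀`, `c > 0`, `c log t₀ ≥ 1`. [folklore] -/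
theorem log_mul_rpow_neg_le {t t₀ c : ℝ} (ht₀ : 0 < t₀) (ht : t₀ ≤ t) (hc : 0 < c)
    (hct : 1 ≤ c * Real.log t₀) :
    Real.log t * t ^ (-c) ≤ Real.log t₀ * t₀ ^ (-c) := by
  have ht0 : 0 < t := ht₀.trans_le ht
  have key : ∀ u : ℝ, 0 < u → Real.log u * u ^ (-c) = c⁻¹ * (Real.log (u ^ c) / u ^ c) := by
    intro u hu
    rw [Real.log_rpow hu, Real.rpow_neg hu.le]
    field_simp
  rw [key t ht0, key t₀ ht₀]
  refine mul_le_mul_of_nonneg_left ?_ (by positivity)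
  have he₀ : Real.exp 1 ≤ t₀ ^ c := by
    rw [← Real.log_le_log_iff (Real.exp_pos 1) (Real.rpow_pos_of_pos ht₀ _), Real.log_exp,
      Real.log_rpow ht₀]
    exact hct
  have hle : t₀ ^ c ≤ t ^ c := Real.rpow_le_rpow ht₀.le ht hc.le
  exact Real.log_div_self_antitoneOn he₀ (he₀.trans hle) hle

/-- **The number of top blocks**: `K₁ ≤ (3/34)(log t)/log ρ` when `θ₂√(2π) ≥ 1`
(`x₀ = √(t/2π)`, `Z = θ₂t^{7/17}`, `Z + 1 ≤ x₀`). [cite: PatelYang2024, Lemma 3.5] -/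
theorem floorLog_blocks_le {t ρ θ₂ : ℝ} (ht : 0 < t) (hρ : 1 < ρ) (hθ₂ : 0 < θ₂)
    (hθ₂π : 1 ≤ θ₂ * Real.sqrt (2 * π)) (hZx : θ₂ * t ^ (7 / 17 : ℝ) + 1 ≤ Real.sqrt (t / (2 * π))) :
    (⌊Real.log (Real.sqrt (t / (2 * π)) / (θ₂ * t ^ (7 / 17 : ℝ) + 1)) / Real.log ρ⌋₊ : ℝ)
      ≤ 3 / 34 * Real.log t / Real.log ρ := by
  have hπ := Real.pi_pos
  have hlog : 0 < Real.log ρ := Real.log_pos hρ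
  have hZ : 0 < θ₂ * t ^ (7 / 17 : ℝ) := by positivity
  have hx₀ : 0 < Real.sqrt (t / (2 * π)) := by linarith
  have h0 : 0 ≤ Real.log (Real.sqrt (t / (2 * π)) / (θ₂ * t ^ (7 / 17 : ℝ) + 1)) / Real.log ρ :=
    div_nonneg (Real.log_nonneg (by rw [le_div_iff₀ (by linarith)]; linarith)) hlog.le
  refine (Nat.floor_le h0).trans ?_
  refine div_le_div_of_nonneg_right ?_ hlog.le
  have h1 : Real.log (Real.sqrt (t / (2 * π)) / (θ₂ * t ^ (7 / 17 : ℝ) + 1))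
      ≤ Real.log (Real.sqrt (t / (2 * π)) / (θ₂ * t ^ (7 / 17 : ℝ))) :=
    Real.log_le_log (by positivity) (div_le_div_of_nonneg_left hx₀.le hZ (by linarith))
  refine h1.trans ?_
  rw [Real.log_div hx₀.ne' hZ.ne', Real.log_sqrt (by positivity), Real.log_div ht.ne' (by positivity),
    Real.log_mul hθ₂.ne' (Real.rpow_pos_of_pos ht _).ne', Real.log_rpow ht]
  have h2 : 0 ≤ Real.log θ₂ + Real.log (2 * π) / 2 := by
    have h3 : Real.log (θ₂ * Real.sqrt (2 * π)) = Real.log θ₂ + Real.log (2 * π) / 2 := by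
      rw [Real.log_mul hθ₂.ne' (Real.sqrt_pos.2 (by positivity)).ne', Real.log_sqrt (by positivity)]
    rw [← h3]; exact Real.log_nonneg hθ₂π
  linarith

/-! ### The constant -/

/-- **The constant `Λ(t₀; ρ₁, H₁, η₁, θ₁, θ₂, ρ₂, H₂, η₂, M₀)`** of the final bound. [cite: PatelYang2024, §3.6] -/
def pyLambda (t₀ ρ₁ H₁ η₁ θ₁ θ₂ ρ₂ H₂ η₂ M₀ : ℝ) : ℝ :=
  2 * (2 * Real.sqrt M₀ * t₀ ^ (-(27 / 164 : ℝ))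
      + pyD3 H₂ η₂ * ((ρ₁ * (θ₂ + t₀ ^ (-(7 / 17 : ℝ)))) ^ (3 / 14 : ℝ) / (ρ₂ ^ (3 / 14 : ℝ) - 1))
          * t₀ ^ (19 / 119 - 27 / 164 : ℝ)
      + pyD4 H₂ η₂ * ((ρ₁ * (θ₂ + t₀ ^ (-(7 / 17 : ℝ)))) ^ (15 / 28 : ℝ) / (ρ₂ ^ (15 / 28 : ℝ) - 1))
          * t₀ ^ (71 / 476 - 27 / 164 : ℝ)
      + pyAlpha H₁ θ₁ θ₂ t₀ *
        (pySK1 H₁ η₁ θ₁ θ₂ t₀ * ((2 * π) ^ (-(5 / 164 : ℝ)) / (ρ₁ ^ (5 / 82 : ℝ) - 1))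
        + pySK2 H₁ η₁ θ₁ θ₂ t₀ * (θ₂ ^ (-(17 / 328 : ℝ)) / (1 - ρ₁ ^ (-(17 / 328 : ℝ))))
        + pySK0 H₁ θ₁ * ((2 * π) ^ (-(87 / 328 : ℝ)) / (ρ₁ ^ (87 / 164 : ℝ) - 1)) * t₀ ^ (-(27 / 328 : ℝ))
        + pySK3 H₁ * (3 / 34 / Real.log ρ₁) * (Real.log t₀ * t₀ ^ (-(27 / 164 : ℝ)))
        + pySK4 H₁ θ₁ θ₂ t₀ * (θ₂ ^ (-(23 / 123 : ℝ)) / (1 - ρ₁ ^ (-(23 / 123 : ℝ))))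
            * t₀ ^ (94 / 2091 - 27 / 164 : ℝ)
        + pySK5 H₁ θ₁ θ₂ t₀ * (θ₂ ^ (-(1 / 41 : ℝ)) / (1 - ρ₁ ^ (-(1 / 41 : ℝ))))
            * t₀ ^ (95 / 697 - 27 / 164 : ℝ)))
    + 2 * (Real.sqrt 2 * (3 / 4)) * t₀ ^ (-(27 / 164 : ℝ))

/-! ### The final bound -/

set_option maxHeartbeats 1600000 in
/-- **`‖ζ(½+it)‖ ≤ Λ t^{27/164}` for `t ≥ t₀`** (Patel–Yang §3.6 with our constants): the
hypotheses are the side conditions at `t₀` (`t₀ ≥ 128π`, `(27/164) log t₀ ≥ 1`,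
`ρ₁(1 + 1/(θ₂t₀^{7/17})) ≤ H₁`, `θ₂√(2π) ≥ 1`, `θ₂t₀^{7/17} ≥ 1`, `(θ₂ + t₀^{-7/17})√(2π) ≤ t₀^{3/34}`,
`2ρ₂ ≤ M₀ ≤ θ₂t₀^{7/17} + 1`, `ρ₂(1 + 1/(M₀/ρ₂ - 1)) ≤ H₂`). [cite: PatelYang2024, §3.6] -/
theorem norm_zeta_half_le_Lambda {t t₀ ρ₁ H₁ η₁ θ₁ θ₂ ρ₂ H₂ η₂ M₀ : ℝ} (ht₀π : 128 * π ≤ t₀)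
    (hlog : 1 ≤ 27 / 164 * Real.log t₀) (ht : t₀ ≤ t) (hρ₁ : 1 < ρ₁)
    (hH₁ : ρ₁ * (1 + 1 / (θ₂ * t₀ ^ (7 / 17 : ℝ))) ≤ H₁) (hη₁ : 0 < η₁) (hθ₁ : 0 < θ₁) (hθ₂ : 0 < θ₂)
    (hθ₂π : 1 ≤ θ₂ * Real.sqrt (2 * π)) (hZ1 : 1 ≤ θ₂ * t₀ ^ (7 / 17 : ℝ))
    (hZx : (θ₂ + t₀ ^ (-(7 / 17 : ℝ))) * Real.sqrt (2 * π) ≤ t₀ ^ (3 / 34 : ℝ))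
    (hρ₂ : 1 < ρ₂) (hM₀ : 2 * ρ₂ ≤ M₀) (hM₀Z : M₀ ≤ θ₂ * t₀ ^ (7 / 17 : ℝ) + 1)
    (hH₂ : ρ₂ * (1 + 1 / (M₀ / ρ₂ - 1)) ≤ H₂) (hη₂ : 0 < η₂) :
    ‖riemannZeta (1 / 2 + t * Complex.I)‖
      ≤ pyLambda t₀ ρ₁ H₁ η₁ θ₁ θ₂ ρ₂ H₂ η₂ M₀ * t ^ (27 / 164 : ℝ) := by
  have hπ := Real.pi_pos
  have hπ3 : 3 < π := Real.pi_gt_three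
  have ht₀ : 0 < t₀ := by nlinarith
  have ht0 : 0 < t := ht₀.trans_le ht
  have ht128 : 128 * π ≤ t := ht₀π.trans ht
  have h2π : 0 < 2 * π := by positivity
  -- powers of `t` versus `t₀`
  have h717 : t₀ ^ (7 / 17 : ℝ) ≤ t ^ (7 / 17 : ℝ) := Real.rpow_le_rpow ht₀.le ht (by norm_num)
  have hZθ0 : 0 < θ₂ * t₀ ^ (7 / 17 : ℝ) := by positivity
  have hZθ : θ₂ * t₀ ^ (7 / 17 : ℝ) ≤ θ₂ * t ^ (7 / 17 : ℝ) := mul_le_mul_of_nonneg_left h717 hθ₂.le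
  -- hypotheses at time `t`
  have hH₁' : ρ₁ * (1 + 1 / (θ₂ * t ^ (7 / 17 : ℝ))) ≤ H₁ := by
    refine le_trans (mul_le_mul_of_nonneg_left ?_ (by linarith)) hH₁
    have := one_div_le_one_div_of_le hZθ0 hZθ
    linarith
  have hZ1' : 1 ≤ θ₂ * t ^ (7 / 17 : ℝ) := hZ1.trans hZθ
  have hM₀Z' : M₀ ≤ θ₂ * t ^ (7 / 17 : ℝ) + 1 := by linarith
  -- `θ₂ t^{7/17} + 1 ≤ (θ₂ + t₀^{-7/17}) t^{7/17} ≤ √(t/2π)`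
  have hone : 1 ≤ t₀ ^ (-(7 / 17 : ℝ)) * t ^ (7 / 17 : ℝ) := by
    have h1 : t₀ ^ (-(7 / 17 : ℝ)) * t₀ ^ (7 / 17 : ℝ) = 1 := by
      rw [← Real.rpow_add ht₀]; norm_num
    calc (1 : ℝ) = t₀ ^ (-(7 / 17 : ℝ)) * t₀ ^ (7 / 17 : ℝ) := h1.symm
      _ ≤ t₀ ^ (-(7 / 17 : ℝ)) * t ^ (7 / 17 : ℝ) :=
          mul_le_mul_of_nonneg_left h717 (Real.rpow_nonneg ht₀.le _)
  have hZsum : θ₂ * t ^ (7 / 17 : ℝ) + 1 ≤ (θ₂ + t₀ ^ (-(7 / 17 : ℝ))) * t ^ (7 / 17 : ℝ) := by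
    nlinarith
  have hsqrt : Real.sqrt (t / (2 * π)) = (2 * π) ^ (-(1 / 2 : ℝ)) * t ^ (1 / 2 : ℝ) := by
    rw [Real.sqrt_eq_rpow, Real.div_rpow ht0.le h2π.le, Real.rpow_neg h2π.le]; ring
  have hs2π : Real.sqrt (2 * π) = (2 * π) ^ (1 / 2 : ℝ) := Real.sqrt_eq_rpow _
  have hZx' : θ₂ * t ^ (7 / 17 : ℝ) + 1 ≤ Real.sqrt (t / (2 * π)) := by
    refine hZsum.trans ?_
    rw [hsqrt]
    have h334 : t₀ ^ (3 / 34 : ℝ) ≤ t ^ (3 / 34 : ℝ) := Real.rpow_le_rpow ht₀.le ht (by norm_num)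
    have hA : θ₂ + t₀ ^ (-(7 / 17 : ℝ)) ≤ (2 * π) ^ (-(1 / 2 : ℝ)) * t ^ (3 / 34 : ℝ) := by
      rw [hs2π] at hZx
      have h1 : (θ₂ + t₀ ^ (-(7 / 17 : ℝ))) * (2 * π) ^ (1 / 2 : ℝ) * (2 * π) ^ (-(1 / 2 : ℝ))
          ≤ t₀ ^ (3 / 34 : ℝ) * (2 * π) ^ (-(1 / 2 : ℝ)) :=
        mul_le_mul_of_nonneg_right hZx (Real.rpow_nonneg h2π.le _)
      have h2 : (2 * π) ^ (1 / 2 : ℝ) * (2 * π) ^ (-(1 / 2 : ℝ)) = 1 := by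
        rw [← Real.rpow_add h2π]; norm_num
      calc θ₂ + t₀ ^ (-(7 / 17 : ℝ)) = (θ₂ + t₀ ^ (-(7 / 17 : ℝ))) * ((2 * π) ^ (1 / 2 : ℝ) * (2 * π) ^ (-(1 / 2 : ℝ))) := by
            rw [h2, mul_one]
        _ ≤ t₀ ^ (3 / 34 : ℝ) * (2 * π) ^ (-(1 / 2 : ℝ)) := by rw [← mul_assoc]; exact h1
        _ ≤ (2 * π) ^ (-(1 / 2 : ℝ)) * t ^ (3 / 34 : ℝ) := by
            rw [mul_comm]; exact mul_le_mul_of_nonneg_left h334 (Real.rpow_nonneg h2π.le _)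
    have h3 : t ^ (3 / 34 : ℝ) * t ^ (7 / 17 : ℝ) = t ^ (1 / 2 : ℝ) := by
      rw [← Real.rpow_add ht0]; norm_num
    calc (θ₂ + t₀ ^ (-(7 / 17 : ℝ))) * t ^ (7 / 17 : ℝ)
        ≤ ((2 * π) ^ (-(1 / 2 : ℝ)) * t ^ (3 / 34 : ℝ)) * t ^ (7 / 17 : ℝ) :=
          mul_le_mul_of_nonneg_right hA (Real.rpow_nonneg ht0.le _)
      _ = (2 * π) ^ (-(1 / 2 : ℝ)) * t ^ (1 / 2 : ℝ) := by rw [mul_assoc, h3]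
  -- the three-range bound
  have hB := norm_zeta_half_le_blocks (η₁ := η₁) (η₂ := η₂) ht₀ ht ht128 hρ₁ hH₁' hη₁ hθ₁ hθ₂ hZ1' hZx'
    hρ₂ hM₀ hM₀Z' hH₂ hη₂
  refine hB.trans ?_
  -- nonnegativity of the coefficients
  have hH₁1 : 1 < H₁ := by
    have h1 : 0 < 1 / (θ₂ * t₀ ^ (7 / 17 : ℝ)) := by positivity
    nlinarith
  have hH₂1 : 1 < H₂ := by
    have hρ0 : 0 < ρ₂ := by linarith
    have hMρ : 2 ≤ M₀ / ρ₂ := by rw [le_div_iff₀ hρ0]; linarith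
    have h1 : 0 < 1 / (M₀ / ρ₂ - 1) := by apply one_div_pos.2; linarith
    nlinarith
  have hα := pyAlpha_nonneg H₁ θ₁ θ₂ t₀
  have hS1 := pySK1_nonneg H₁ η₁ θ₁ θ₂ t₀
  have hS2 := pySK2_nonneg H₁ η₁ θ₁ θ₂ t₀
  have hS0 := pySK0_nonneg H₁ θ₁
  have hS3 := pySK3_nonneg H₁
  have hS4 := pySK4_nonneg H₁ θ₁ θ₂ t₀
  have hS5 := pySK5_nonneg H₁ θ₁ θ₂ t₀
  have hD3 := pyD3_nonneg hH₂1 hη₂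
  have hD4 := pyD4_nonneg hH₂1 hη₂
  have hρ₂d1 : 0 < ρ₂ ^ (3 / 14 : ℝ) - 1 := by linarith [Real.one_lt_rpow hρ₂ (by norm_num : (0:ℝ) < 3 / 14)]
  have hρ₂d2 : 0 < ρ₂ ^ (15 / 28 : ℝ) - 1 := by linarith [Real.one_lt_rpow hρ₂ (by norm_num : (0:ℝ) < 15 / 28)]
  have hρ₁d1 : 0 < ρ₁ ^ (5 / 82 : ℝ) - 1 := by linarith [Real.one_lt_rpow hρ₁ (by norm_num : (0:ℝ) < 5 / 82)]
  have hρ₁d0 : 0 < ρ₁ ^ (87 / 164 : ℝ) - 1 := by linarith [Real.one_lt_rpow hρ₁ (by norm_num : (0:ℝ) < 87 / 164)]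
  have hden : ∀ x : ℝ, x < 0 → 0 < 1 - ρ₁ ^ x := fun x hx => by
    have : ρ₁ ^ x < 1 := Real.rpow_lt_one_of_one_lt_of_neg hρ₁ hx
    linarith
  have hd2 := hden (-(17 / 328)) (by norm_num)
  have hd4 := hden (-(23 / 123)) (by norm_num)
  have hd5 := hden (-(1 / 41)) (by norm_num)
  set c : ℝ := (27 / 164 : ℝ) with hc
  have htc : 0 < t ^ c := Real.rpow_pos_of_pos ht0 _
  -- (i) constants
  have r0 : (1 : ℝ) ≤ t₀ ^ (-(27 / 164 : ℝ)) * t ^ c := by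
    have := rpow_le_rpow_t0 (y := 0) ht₀ ht (by norm_num : (0:ℝ) ≤ 27 / 164)
    rw [Real.rpow_zero] at this
    convert this using 2; norm_num
  -- (ii)-(iii) middle range
  have hW : ρ₁ * (θ₂ * t ^ (7 / 17 : ℝ) + 1) ≤ (ρ₁ * (θ₂ + t₀ ^ (-(7 / 17 : ℝ)))) * t ^ (7 / 17 : ℝ) := by
    have := mul_le_mul_of_nonneg_left hZsum (by linarith : (0:ℝ) ≤ ρ₁)
    linarith [this]
  have hW0 : 0 ≤ ρ₁ * (θ₂ * t ^ (7 / 17 : ℝ) + 1) := by positivity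
  have hWc0 : 0 ≤ ρ₁ * (θ₂ + t₀ ^ (-(7 / 17 : ℝ))) := by positivity
  have mid1 : t ^ (1 / 14 : ℝ) * (ρ₁ * (θ₂ * t ^ (7 / 17 : ℝ) + 1)) ^ (3 / 14 : ℝ)
      ≤ (ρ₁ * (θ₂ + t₀ ^ (-(7 / 17 : ℝ)))) ^ (3 / 14 : ℝ) * t₀ ^ (19 / 119 - 27 / 164 : ℝ) * t ^ c := by
    have h1 : (ρ₁ * (θ₂ * t ^ (7 / 17 : ℝ) + 1)) ^ (3 / 14 : ℝ)
        ≤ (ρ₁ * (θ₂ + t₀ ^ (-(7 / 17 : ℝ)))) ^ (3 / 14 : ℝ) * t ^ ((7 / 17 : ℝ) * (3 / 14)) := by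
      have := Real.rpow_le_rpow hW0 hW (by norm_num : (0:ℝ) ≤ 3 / 14)
      rwa [Real.mul_rpow hWc0 (Real.rpow_nonneg ht0.le _), ← Real.rpow_mul ht0.le] at this
    have h2 : t ^ (1 / 14 : ℝ) * t ^ ((7 / 17 : ℝ) * (3 / 14)) = t ^ (19 / 119 : ℝ) := by
      rw [← Real.rpow_add ht0]; norm_num
    have h3 := rpow_le_rpow_t0 (y := 19 / 119) ht₀ ht (by norm_num : (19 / 119 : ℝ) ≤ 27 / 164)
    calc t ^ (1 / 14 : ℝ) * (ρ₁ * (θ₂ * t ^ (7 / 17 : ℝ) + 1)) ^ (3 / 14 : ℝ)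
        ≤ t ^ (1 / 14 : ℝ) * ((ρ₁ * (θ₂ + t₀ ^ (-(7 / 17 : ℝ)))) ^ (3 / 14 : ℝ) * t ^ ((7 / 17 : ℝ) * (3 / 14))) :=
          mul_le_mul_of_nonneg_left h1 (Real.rpow_nonneg ht0.le _)
      _ = (ρ₁ * (θ₂ + t₀ ^ (-(7 / 17 : ℝ)))) ^ (3 / 14 : ℝ) * t ^ (19 / 119 : ℝ) := by rw [← h2]; ring
      _ ≤ (ρ₁ * (θ₂ + t₀ ^ (-(7 / 17 : ℝ)))) ^ (3 / 14 : ℝ) * (t₀ ^ (19 / 119 - 27 / 164 : ℝ) * t ^ c) :=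
          mul_le_mul_of_nonneg_left h3 (Real.rpow_nonneg hWc0 _)
      _ = _ := by ring
  have mid2 : t ^ (-(1 / 14 : ℝ)) * (ρ₁ * (θ₂ * t ^ (7 / 17 : ℝ) + 1)) ^ (15 / 28 : ℝ)
      ≤ (ρ₁ * (θ₂ + t₀ ^ (-(7 / 17 : ℝ)))) ^ (15 / 28 : ℝ) * t₀ ^ (71 / 476 - 27 / 164 : ℝ) * t ^ c := by
    have h1 : (ρ₁ * (θ₂ * t ^ (7 / 17 : ℝ) + 1)) ^ (15 / 28 : ℝ)
        ≤ (ρ₁ * (θ₂ + t₀ ^ (-(7 / 17 : ℝ)))) ^ (15 / 28 : ℝ) * t ^ ((7 / 17 : ℝ) * (15 / 28)) := by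
      have := Real.rpow_le_rpow hW0 hW (by norm_num : (0:ℝ) ≤ 15 / 28)
      rwa [Real.mul_rpow hWc0 (Real.rpow_nonneg ht0.le _), ← Real.rpow_mul ht0.le] at this
    have h2 : t ^ (-(1 / 14 : ℝ)) * t ^ ((7 / 17 : ℝ) * (15 / 28)) = t ^ (71 / 476 : ℝ) := by
      rw [← Real.rpow_add ht0]; norm_num
    have h3 := rpow_le_rpow_t0 (y := 71 / 476) ht₀ ht (by norm_num : (71 / 476 : ℝ) ≤ 27 / 164)
    calc t ^ (-(1 / 14 : ℝ)) * (ρ₁ * (θ₂ * t ^ (7 / 17 : ℝ) + 1)) ^ (15 / 28 : ℝ)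
        ≤ t ^ (-(1 / 14 : ℝ)) * ((ρ₁ * (θ₂ + t₀ ^ (-(7 / 17 : ℝ)))) ^ (15 / 28 : ℝ) * t ^ ((7 / 17 : ℝ) * (15 / 28))) :=
          mul_le_mul_of_nonneg_left h1 (Real.rpow_nonneg ht0.le _)
      _ = (ρ₁ * (θ₂ + t₀ ^ (-(7 / 17 : ℝ)))) ^ (15 / 28 : ℝ) * t ^ (71 / 476 : ℝ) := by rw [← h2]; ring
      _ ≤ (ρ₁ * (θ₂ + t₀ ^ (-(7 / 17 : ℝ)))) ^ (15 / 28 : ℝ) * (t₀ ^ (71 / 476 - 27 / 164 : ℝ) * t ^ c) :=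
          mul_le_mul_of_nonneg_left h3 (Real.rpow_nonneg hWc0 _)
      _ = _ := by ring
  -- (iv)-(ix) top range
  have hx5 : (Real.sqrt (t / (2 * π))) ^ (5 / 82 : ℝ) = (2 * π) ^ (-(5 / 164 : ℝ)) * t ^ (5 / 164 : ℝ) := by
    rw [hsqrt, Real.mul_rpow (Real.rpow_nonneg h2π.le _) (Real.rpow_nonneg ht0.le _),
      ← Real.rpow_mul h2π.le, ← Real.rpow_mul ht0.le]; norm_num
  have hx87 : (Real.sqrt (t / (2 * π))) ^ (87 / 164 : ℝ) = (2 * π) ^ (-(87 / 328 : ℝ)) * t ^ (87 / 328 : ℝ) := by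
    rw [hsqrt, Real.mul_rpow (Real.rpow_nonneg h2π.le _) (Real.rpow_nonneg ht0.le _),
      ← Real.rpow_mul h2π.le, ← Real.rpow_mul ht0.le]; norm_num
  have hZp : ∀ x : ℝ, (θ₂ * t ^ (7 / 17 : ℝ)) ^ x = θ₂ ^ x * t ^ ((7 / 17 : ℝ) * x) := fun x => by
    rw [Real.mul_rpow hθ₂.le (Real.rpow_nonneg ht0.le _), ← Real.rpow_mul ht0.le]
  have top1 : t ^ (11 / 82 : ℝ) * (Real.sqrt (t / (2 * π))) ^ (5 / 82 : ℝ) = (2 * π) ^ (-(5 / 164 : ℝ)) * t ^ c := by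
    rw [hx5, hc]
    have : t ^ (11 / 82 : ℝ) * t ^ (5 / 164 : ℝ) = t ^ (27 / 164 : ℝ) := by rw [← Real.rpow_add ht0]; norm_num
    rw [← this]; ring
  have top2 : t ^ (61 / 328 : ℝ) * (θ₂ * t ^ (7 / 17 : ℝ)) ^ (-(17 / 328 : ℝ)) = θ₂ ^ (-(17 / 328 : ℝ)) * t ^ c := by
    rw [hZp, hc]
    have : t ^ (61 / 328 : ℝ) * t ^ ((7 / 17 : ℝ) * -(17 / 328)) = t ^ (27 / 164 : ℝ) := by
      rw [← Real.rpow_add ht0]; norm_num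
    rw [← this]; ring
  have top0 : t ^ (-(15 / 82 : ℝ)) * (Real.sqrt (t / (2 * π))) ^ (87 / 164 : ℝ)
      ≤ (2 * π) ^ (-(87 / 328 : ℝ)) * t₀ ^ (-(27 / 328 : ℝ)) * t ^ c := by
    rw [hx87]
    have h1 : t ^ (-(15 / 82 : ℝ)) * t ^ (87 / 328 : ℝ) = t ^ (27 / 328 : ℝ) := by rw [← Real.rpow_add ht0]; norm_num
    have h3 := rpow_le_rpow_t0 (y := 27 / 328) ht₀ ht (by norm_num : (27 / 328 : ℝ) ≤ 27 / 164)
    have e : (27 / 328 - 27 / 164 : ℝ) = -(27 / 328) := by norm_num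
    rw [e] at h3
    calc t ^ (-(15 / 82 : ℝ)) * ((2 * π) ^ (-(87 / 328 : ℝ)) * t ^ (87 / 328 : ℝ))
        = (2 * π) ^ (-(87 / 328 : ℝ)) * t ^ (27 / 328 : ℝ) := by rw [← h1]; ring
      _ ≤ (2 * π) ^ (-(87 / 328 : ℝ)) * (t₀ ^ (-(27 / 328 : ℝ)) * t ^ c) :=
          mul_le_mul_of_nonneg_left h3 (Real.rpow_nonneg h2π.le _)
      _ = _ := by ring
  have top3 : (⌊Real.log (Real.sqrt (t / (2 * π)) / (θ₂ * t ^ (7 / 17 : ℝ) + 1)) / Real.log ρ₁⌋₊ : ℝ)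
      ≤ (3 / 34 / Real.log ρ₁) * (Real.log t₀ * t₀ ^ (-(27 / 164 : ℝ))) * t ^ c := by
    have h1 := floorLog_blocks_le ht0 hρ₁ hθ₂ hθ₂π hZx'
    have h2 := log_mul_rpow_neg_le (c := 27 / 164) ht₀ ht (by norm_num) hlog
    have hlρ : 0 < Real.log ρ₁ := Real.log_pos hρ₁
    have h3 : Real.log t = (Real.log t * t ^ (-(27 / 164 : ℝ))) * t ^ c := by
      rw [mul_assoc, ← Real.rpow_add ht0, hc]; norm_num
    have hlt0 : 0 ≤ Real.log t := Real.log_nonneg (by nlinarith)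
    calc (⌊Real.log (Real.sqrt (t / (2 * π)) / (θ₂ * t ^ (7 / 17 : ℝ) + 1)) / Real.log ρ₁⌋₊ : ℝ)
        ≤ 3 / 34 * Real.log t / Real.log ρ₁ := h1
      _ = (3 / 34 / Real.log ρ₁) * ((Real.log t * t ^ (-(27 / 164 : ℝ))) * t ^ c) := by
          rw [← h3]; field_simp
      _ ≤ (3 / 34 / Real.log ρ₁) * ((Real.log t₀ * t₀ ^ (-(27 / 164 : ℝ))) * t ^ c) := by
          refine mul_le_mul_of_nonneg_left (mul_le_mul_of_nonneg_right h2 htc.le) (by positivity)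
      _ = _ := by ring
  have top4 : t ^ (5 / 41 : ℝ) * (θ₂ * t ^ (7 / 17 : ℝ)) ^ (-(23 / 123 : ℝ))
      ≤ θ₂ ^ (-(23 / 123 : ℝ)) * t₀ ^ (94 / 2091 - 27 / 164 : ℝ) * t ^ c := by
    rw [hZp]
    have h1 : t ^ (5 / 41 : ℝ) * t ^ ((7 / 17 : ℝ) * -(23 / 123)) = t ^ (94 / 2091 : ℝ) := by
      rw [← Real.rpow_add ht0]; norm_num
    have h3 := rpow_le_rpow_t0 (y := 94 / 2091) ht₀ ht (by norm_num : (94 / 2091 : ℝ) ≤ 27 / 164)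
    calc t ^ (5 / 41 : ℝ) * (θ₂ ^ (-(23 / 123 : ℝ)) * t ^ ((7 / 17 : ℝ) * -(23 / 123)))
        = θ₂ ^ (-(23 / 123 : ℝ)) * t ^ (94 / 2091 : ℝ) := by rw [← h1]; ring
      _ ≤ θ₂ ^ (-(23 / 123 : ℝ)) * (t₀ ^ (94 / 2091 - 27 / 164 : ℝ) * t ^ c) :=
          mul_le_mul_of_nonneg_left h3 (Real.rpow_nonneg hθ₂.le _)
      _ = _ := by ring
  have top5 : t ^ (6 / 41 : ℝ) * (θ₂ * t ^ (7 / 17 : ℝ)) ^ (-(1 / 41 : ℝ))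
      ≤ θ₂ ^ (-(1 / 41 : ℝ)) * t₀ ^ (95 / 697 - 27 / 164 : ℝ) * t ^ c := by
    rw [hZp]
    have h1 : t ^ (6 / 41 : ℝ) * t ^ ((7 / 17 : ℝ) * -(1 / 41)) = t ^ (95 / 697 : ℝ) := by
      rw [← Real.rpow_add ht0]; norm_num
    have h3 := rpow_le_rpow_t0 (y := 95 / 697) ht₀ ht (by norm_num : (95 / 697 : ℝ) ≤ 27 / 164)
    calc t ^ (6 / 41 : ℝ) * (θ₂ ^ (-(1 / 41 : ℝ)) * t ^ ((7 / 17 : ℝ) * -(1 / 41)))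
        = θ₂ ^ (-(1 / 41 : ℝ)) * t ^ (95 / 697 : ℝ) := by rw [← h1]; ring
      _ ≤ θ₂ ^ (-(1 / 41 : ℝ)) * (t₀ ^ (95 / 697 - 27 / 164 : ℝ) * t ^ c) :=
          mul_le_mul_of_nonneg_left h3 (Real.rpow_nonneg hθ₂.le _)
      _ = _ := by ring
  -- multiply by the (nonnegative) coefficients and add up
  have M0 : 2 * Real.sqrt M₀ ≤ 2 * Real.sqrt M₀ * (t₀ ^ (-(27 / 164 : ℝ)) * t ^ c) :=
    le_mul_of_one_le_right (by positivity) r0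
  have MRS : 2 * (Real.sqrt 2 * (3 / 4)) ≤ 2 * (Real.sqrt 2 * (3 / 4)) * (t₀ ^ (-(27 / 164 : ℝ)) * t ^ c) :=
    le_mul_of_one_le_right (by positivity) r0
  have M1 := mul_le_mul_of_nonneg_left mid1 (div_nonneg hD3 hρ₂d1.le : 0 ≤ pyD3 H₂ η₂ / (ρ₂ ^ (3 / 14 : ℝ) - 1))
  have M2 := mul_le_mul_of_nonneg_left mid2 (div_nonneg hD4 hρ₂d2.le : 0 ≤ pyD4 H₂ η₂ / (ρ₂ ^ (15 / 28 : ℝ) - 1))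
  have T1 : pySK1 H₁ η₁ θ₁ θ₂ t₀ * t ^ (11 / 82 : ℝ) * ((Real.sqrt (t / (2 * π))) ^ (5 / 82 : ℝ) / (ρ₁ ^ (5 / 82 : ℝ) - 1))
      = pySK1 H₁ η₁ θ₁ θ₂ t₀ * ((2 * π) ^ (-(5 / 164 : ℝ)) / (ρ₁ ^ (5 / 82 : ℝ) - 1)) * t ^ c := by
    rw [mul_div_assoc', ← mul_div_assoc, mul_assoc (pySK1 H₁ η₁ θ₁ θ₂ t₀), top1]; ring
  have T2 : pySK2 H₁ η₁ θ₁ θ₂ t₀ * t ^ (61 / 328 : ℝ) * ((θ₂ * t ^ (7 / 17 : ℝ)) ^ (-(17 / 328 : ℝ)) / (1 - ρ₁ ^ (-(17 / 328 : ℝ))))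
      = pySK2 H₁ η₁ θ₁ θ₂ t₀ * (θ₂ ^ (-(17 / 328 : ℝ)) / (1 - ρ₁ ^ (-(17 / 328 : ℝ)))) * t ^ c := by
    rw [mul_div_assoc', ← mul_div_assoc, mul_assoc (pySK2 H₁ η₁ θ₁ θ₂ t₀), top2]; ring
  have T0 := mul_le_mul_of_nonneg_left top0 (div_nonneg hS0 hρ₁d0.le : 0 ≤ pySK0 H₁ θ₁ / (ρ₁ ^ (87 / 164 : ℝ) - 1))
  have T3 := mul_le_mul_of_nonneg_left top3 hS3
  have T4 := mul_le_mul_of_nonneg_left top4 (div_nonneg hS4 hd4.le : 0 ≤ pySK4 H₁ θ₁ θ₂ t₀ / (1 - ρ₁ ^ (-(23 / 123 : ℝ))))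
  have T5 := mul_le_mul_of_nonneg_left top5 (div_nonneg hS5 hd5.le : 0 ≤ pySK5 H₁ θ₁ θ₂ t₀ / (1 - ρ₁ ^ (-(1 / 41 : ℝ))))
  -- the top bracket
  have hTop : pySK1 H₁ η₁ θ₁ θ₂ t₀ * t ^ (11 / 82 : ℝ) * ((Real.sqrt (t / (2 * π))) ^ (5 / 82 : ℝ) / (ρ₁ ^ (5 / 82 : ℝ) - 1))
        + pySK2 H₁ η₁ θ₁ θ₂ t₀ * t ^ (61 / 328 : ℝ) * ((θ₂ * t ^ (7 / 17 : ℝ)) ^ (-(17 / 328 : ℝ)) / (1 - ρ₁ ^ (-(17 / 328 : ℝ))))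
        + pySK0 H₁ θ₁ * t ^ (-(15 / 82 : ℝ)) * ((Real.sqrt (t / (2 * π))) ^ (87 / 164 : ℝ) / (ρ₁ ^ (87 / 164 : ℝ) - 1))
        + pySK3 H₁ * ⌊Real.log (Real.sqrt (t / (2 * π)) / (θ₂ * t ^ (7 / 17 : ℝ) + 1)) / Real.log ρ₁⌋₊
        + pySK4 H₁ θ₁ θ₂ t₀ * t ^ (5 / 41 : ℝ) * ((θ₂ * t ^ (7 / 17 : ℝ)) ^ (-(23 / 123 : ℝ)) / (1 - ρ₁ ^ (-(23 / 123 : ℝ))))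
        + pySK5 H₁ θ₁ θ₂ t₀ * t ^ (6 / 41 : ℝ) * ((θ₂ * t ^ (7 / 17 : ℝ)) ^ (-(1 / 41 : ℝ)) / (1 - ρ₁ ^ (-(1 / 41 : ℝ))))
      ≤ (pySK1 H₁ η₁ θ₁ θ₂ t₀ * ((2 * π) ^ (-(5 / 164 : ℝ)) / (ρ₁ ^ (5 / 82 : ℝ) - 1))
        + pySK2 H₁ η₁ θ₁ θ₂ t₀ * (θ₂ ^ (-(17 / 328 : ℝ)) / (1 - ρ₁ ^ (-(17 / 328 : ℝ))))
        + pySK0 H₁ θ₁ * ((2 * π) ^ (-(87 / 328 : ℝ)) / (ρ₁ ^ (87 / 164 : ℝ) - 1)) * t₀ ^ (-(27 / 328 : ℝ))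
        + pySK3 H₁ * (3 / 34 / Real.log ρ₁) * (Real.log t₀ * t₀ ^ (-(27 / 164 : ℝ)))
        + pySK4 H₁ θ₁ θ₂ t₀ * (θ₂ ^ (-(23 / 123 : ℝ)) / (1 - ρ₁ ^ (-(23 / 123 : ℝ)))) * t₀ ^ (94 / 2091 - 27 / 164 : ℝ)
        + pySK5 H₁ θ₁ θ₂ t₀ * (θ₂ ^ (-(1 / 41 : ℝ)) / (1 - ρ₁ ^ (-(1 / 41 : ℝ)))) * t₀ ^ (95 / 697 - 27 / 164 : ℝ))
        * t ^ c := by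
    have e0 : pySK0 H₁ θ₁ * t ^ (-(15 / 82 : ℝ)) * ((Real.sqrt (t / (2 * π))) ^ (87 / 164 : ℝ) / (ρ₁ ^ (87 / 164 : ℝ) - 1))
        = pySK0 H₁ θ₁ / (ρ₁ ^ (87 / 164 : ℝ) - 1) * (t ^ (-(15 / 82 : ℝ)) * (Real.sqrt (t / (2 * π))) ^ (87 / 164 : ℝ)) := by
      ring
    have e4 : pySK4 H₁ θ₁ θ₂ t₀ * t ^ (5 / 41 : ℝ) * ((θ₂ * t ^ (7 / 17 : ℝ)) ^ (-(23 / 123 : ℝ)) / (1 - ρ₁ ^ (-(23 / 123 : ℝ))))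
        = pySK4 H₁ θ₁ θ₂ t₀ / (1 - ρ₁ ^ (-(23 / 123 : ℝ))) * (t ^ (5 / 41 : ℝ) * (θ₂ * t ^ (7 / 17 : ℝ)) ^ (-(23 / 123 : ℝ))) := by
      ring
    have e5 : pySK5 H₁ θ₁ θ₂ t₀ * t ^ (6 / 41 : ℝ) * ((θ₂ * t ^ (7 / 17 : ℝ)) ^ (-(1 / 41 : ℝ)) / (1 - ρ₁ ^ (-(1 / 41 : ℝ))))
        = pySK5 H₁ θ₁ θ₂ t₀ / (1 - ρ₁ ^ (-(1 / 41 : ℝ))) * (t ^ (6 / 41 : ℝ) * (θ₂ * t ^ (7 / 17 : ℝ)) ^ (-(1 / 41 : ℝ))) := by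
      ring
    rw [T1, T2, e0, e4, e5]
    have f0 : pySK0 H₁ θ₁ / (ρ₁ ^ (87 / 164 : ℝ) - 1) * ((2 * π) ^ (-(87 / 328 : ℝ)) * t₀ ^ (-(27 / 328 : ℝ)) * t ^ c)
        = pySK0 H₁ θ₁ * ((2 * π) ^ (-(87 / 328 : ℝ)) / (ρ₁ ^ (87 / 164 : ℝ) - 1)) * t₀ ^ (-(27 / 328 : ℝ)) * t ^ c := by
      ring
    have f4 : pySK4 H₁ θ₁ θ₂ t₀ / (1 - ρ₁ ^ (-(23 / 123 : ℝ))) * (θ₂ ^ (-(23 / 123 : ℝ)) * t₀ ^ (94 / 2091 - 27 / 164 : ℝ) * t ^ c)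
        = pySK4 H₁ θ₁ θ₂ t₀ * (θ₂ ^ (-(23 / 123 : ℝ)) / (1 - ρ₁ ^ (-(23 / 123 : ℝ)))) * t₀ ^ (94 / 2091 - 27 / 164 : ℝ) * t ^ c := by
      ring
    have f5 : pySK5 H₁ θ₁ θ₂ t₀ / (1 - ρ₁ ^ (-(1 / 41 : ℝ))) * (θ₂ ^ (-(1 / 41 : ℝ)) * t₀ ^ (95 / 697 - 27 / 164 : ℝ) * t ^ c)
        = pySK5 H₁ θ₁ θ₂ t₀ * (θ₂ ^ (-(1 / 41 : ℝ)) / (1 - ρ₁ ^ (-(1 / 41 : ℝ)))) * t₀ ^ (95 / 697 - 27 / 164 : ℝ) * t ^ c := by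
      ring
    linarith [T0, T3, T4, T5, f0, f4, f5]
  have hTop' := mul_le_mul_of_nonneg_left hTop hα
  -- the middle bracket
  have hMid : pyD3 H₂ η₂ * t ^ (1 / 14 : ℝ) * ((ρ₁ * (θ₂ * t ^ (7 / 17 : ℝ) + 1)) ^ (3 / 14 : ℝ) / (ρ₂ ^ (3 / 14 : ℝ) - 1))
        + pyD4 H₂ η₂ * t ^ (-(1 / 14 : ℝ)) * ((ρ₁ * (θ₂ * t ^ (7 / 17 : ℝ) + 1)) ^ (15 / 28 : ℝ) / (ρ₂ ^ (15 / 28 : ℝ) - 1))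
      ≤ (pyD3 H₂ η₂ * ((ρ₁ * (θ₂ + t₀ ^ (-(7 / 17 : ℝ)))) ^ (3 / 14 : ℝ) / (ρ₂ ^ (3 / 14 : ℝ) - 1)) * t₀ ^ (19 / 119 - 27 / 164 : ℝ)
        + pyD4 H₂ η₂ * ((ρ₁ * (θ₂ + t₀ ^ (-(7 / 17 : ℝ)))) ^ (15 / 28 : ℝ) / (ρ₂ ^ (15 / 28 : ℝ) - 1)) * t₀ ^ (71 / 476 - 27 / 164 : ℝ))
        * t ^ c := by
    have e1 : pyD3 H₂ η₂ * t ^ (1 / 14 : ℝ) * ((ρ₁ * (θ₂ * t ^ (7 / 17 : ℝ) + 1)) ^ (3 / 14 : ℝ) / (ρ₂ ^ (3 / 14 : ℝ) - 1))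
        = pyD3 H₂ η₂ / (ρ₂ ^ (3 / 14 : ℝ) - 1) * (t ^ (1 / 14 : ℝ) * (ρ₁ * (θ₂ * t ^ (7 / 17 : ℝ) + 1)) ^ (3 / 14 : ℝ)) := by
      ring
    have e2 : pyD4 H₂ η₂ * t ^ (-(1 / 14 : ℝ)) * ((ρ₁ * (θ₂ * t ^ (7 / 17 : ℝ) + 1)) ^ (15 / 28 : ℝ) / (ρ₂ ^ (15 / 28 : ℝ) - 1))
        = pyD4 H₂ η₂ / (ρ₂ ^ (15 / 28 : ℝ) - 1) * (t ^ (-(1 / 14 : ℝ)) * (ρ₁ * (θ₂ * t ^ (7 / 17 : ℝ) + 1)) ^ (15 / 28 : ℝ)) := by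
      ring
    rw [e1, e2]
    have f1 : pyD3 H₂ η₂ / (ρ₂ ^ (3 / 14 : ℝ) - 1) * ((ρ₁ * (θ₂ + t₀ ^ (-(7 / 17 : ℝ)))) ^ (3 / 14 : ℝ) * t₀ ^ (19 / 119 - 27 / 164 : ℝ) * t ^ c)
        = pyD3 H₂ η₂ * ((ρ₁ * (θ₂ + t₀ ^ (-(7 / 17 : ℝ)))) ^ (3 / 14 : ℝ) / (ρ₂ ^ (3 / 14 : ℝ) - 1)) * t₀ ^ (19 / 119 - 27 / 164 : ℝ) * t ^ c := by
      ring
    have f2 : pyD4 H₂ η₂ / (ρ₂ ^ (15 / 28 : ℝ) - 1) * ((ρ₁ * (θ₂ + t₀ ^ (-(7 / 17 : ℝ)))) ^ (15 / 28 : ℝ) * t₀ ^ (71 / 476 - 27 / 164 : ℝ) * t ^ c)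
        = pyD4 H₂ η₂ * ((ρ₁ * (θ₂ + t₀ ^ (-(7 / 17 : ℝ)))) ^ (15 / 28 : ℝ) / (ρ₂ ^ (15 / 28 : ℝ) - 1)) * t₀ ^ (71 / 476 - 27 / 164 : ℝ) * t ^ c := by
      ring
    linarith [M1, M2, f1, f2]
  unfold pyLambda
  rw [hc] at hTop' hMid M0 MRS
  linarith [hTop', hMid, M0, MRS]


end VdC
end Literature.NumberTheory.LFunctions
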